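import Literature.Probability.RandomPlanarGeometry.HexSAWSurfaceWallRateStrictMono
import Literature.Probability.RandomPlanarGeometry.HexSAWSurfaceWallRenewalCubeRange
import HarnessLib

/-!
# The adsorbed growth rate is STRICTLY increasing in the surface fugacity down to `y > μ³`:
# `(y'/y)^{1/m(y)} ≤ β(y')²/β(y)² ≤ y'/y` for `μ³ < y ≤ y'`

Topic `Literature/Probability/RandomPlanarGeometry` (lane «pcv-sawmu», a-p6 g19, car «STRICT-RATE-CUBE»; parents, all TREE:
`HexSAWSurfaceWallRateStrictMono.lean` (a-idea-1, door «STRICT-RATE»: the all-`y` two-fugacity comparison `IPWB_le_div_mul_IPWB :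
Λ_n(y) ≤ (y/y')·Λ_n(y')` and, for `y > μ⁴`, Jensen for Kesten's block law, `(y'/y)^{1/m(y)} ≤ β(y')²/β(y)²`, `strictMonoOn_wallRate` on
`(μ⁴, ∞)`), `HexSAWSurfaceWallRenewalCubeRange.lean` (a-p6 g19: Kesten's relation `hasSum_pwbLaw_of_cube_lt`, the finite mean
`summable_mul_pwbLaw_of_cube_lt`, `pwbMean_pos_of_cube_lt`, the explicit mean bound `pwbMean_le_of_cube_lt` on `y > μ³`, all from the
six-step law of `HexSAWSurfaceWallRenewalSixStep.lean` (a-idea-1 g33)), `HexSAWSurfaceWallRateSqrtMonotone.lean` (`wallRate_le_sqrt_mul`,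
`wallRate_mono`: the upper envelope, every `y`)).

WHAT IS PROVED — the parent's §2–§5 VERBATIM IN FORM with `hexConnectiveConstant ^ 4 < y` replaced by `hexConnectiveConstant ^ 3 < y`:
`rpow_pwbMean_le_tsum_mul_pow_of_cube_lt` (Jensen: `r^{m(y)} ≤ Σ f_k(y) r^k`), `tsum_pwbLaw_mul_pow_le_div_of_cube_lt`,
★ `rpow_pwbMean_sq_wallRate_div_le_of_cube_lt : (β(y)²/β(y')²)^{m(y)} ≤ y/y'`, ★★ `log_div_le_pwbMean_mul_log_of_cube_lt :
log(y'/y) ≤ m(y)·log(β(y')²/β(y)²)`, `div_rpow_inv_pwbMean_le_of_cube_lt : (y'/y)^{1/m(y)} ≤ β(y')²/β(y)²`,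
★★ `log_sq_wallRate_div_two_sided_of_cube_lt`, ★★ `wallRate_lt_wallRate_of_cube_lt` / **`strictMonoOn_wallRate_of_cube_lt :
StrictMonoOn wallRate (Set.Ioi (μ³))`** — the wall-bridge growth rate is STRICTLY increasing on `(μ³, ∞) ⊃ (μ⁴, ∞)`;
`log_div_le_explicit_mul_log_of_cube_lt` with the explicit exponent `1/M₃(y)`, `M₃ = 1 + (μ² + y^{2/3}/μ²)θ₃²/(1−θ₃)²`;
`log_div_le_mul_log_of_pwbMean_le_of_cube_lt`, `monotoneOn_log_sq_wallRate_sub_of_cube_lt` (uniform exponent from a mean certificate on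
`[y₀, ∞)`, `y₀ > μ³`).

HONEST LABEL.  LANE THEOREM (range extension), DERIVED: the parent's Jensen / two-fugacity argument, unchanged, fed with the `μ³`-range
Kesten relation and finite mean of `HexSAWSurfaceWallRenewalCubeRange`.  NEW IN WRITING (modest): strict monotonicity of `β` with the
explicit local exponent on the explicit range `y > (2+√2)^{3/2}`; the qualitative facts in print (convex non-decreasing free energy,
positive visit density in the adsorbed phase: [HammersleyTorrieWhittington1982, §2], [JansevanRensburg2000, §3.3 and §5.4],
[BeatonBousquetMelouDeGierDuminilCopinGuttmann2014, §3.1, Proposition 5], pinning models [Hollander2009, §7.1]) and the sources of the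
mechanism ([MadrasSlade1993, §4.2, (4.2.4), Theorem 4.2.2 (pp. 91–92)], [Kesten1963SAW, §4], [Feller1968, XIII.3, XIII.10]) are the
parent's.  NOT CLAIMED: anything for `y ≤ μ³` (nothing near `y_c = 1 + √2`); differentiability (see «NO-KINK-CUBE»); numerics.  No definitions.
-/

noncomputable section

open Finset Filter Function
open Literature.Probability.LatticeModels
open _root_.Topology

namespace Literature.Probability.RandomPlanarGeometry.SAW.HexBW.Wall

variable {y y' : ℝ} {n : ℕ} {ω : ℕ → Site 2}

/-! ## 2. Jensen for Kesten's block law on `y > μ³` -/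

/-- Convexity of the exponential at `t₀`: `e^{t₀}·(1 + (t − t₀)) ≤ e^t`.
[cite: Feller1968, XIII.3 (generating functions of a renewal law; convexity)] -/
private theorem exp_mul_one_add_sub_le_exp_src (t t₀ : ℝ) : Real.exp t₀ * (1 + (t - t₀)) ≤ Real.exp t := by
  have h := Real.add_one_le_exp (t - t₀)
  calc Real.exp t₀ * (1 + (t - t₀)) ≤ Real.exp t₀ * Real.exp (t - t₀) :=
        mul_le_mul_of_nonneg_left (by linarith) (Real.exp_pos _).le
    _ = Real.exp t := by rw [← Real.exp_add]; ring_nf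

/-- **Jensen's inequality for the first-renewal law** `f(y)` (mean `m(y)`): `r^{m(y)} ≤ Σ_k f_k(y) r^k` for `0 < r ≤ 1` (`y > μ³`).
Proof: sum the tangent inequality `r^{m}(1 + (k − m) log r) ≤ r^k` against `Σ f_k = 1`, `Σ k f_k = m`.
[cite: Feller1968, XIII.3, Theorem 1 (a persistent renewal law has total mass 1) and XIII.10] [cite: MadrasSlade1993, §4.2, (4.2.4) (p. 91)] -/
theorem rpow_pwbMean_le_tsum_mul_pow_of_cube_lt (hy : hexConnectiveConstant ^ 3 < y) {r : ℝ} (hr : 0 < r) (hr1 : r ≤ 1) :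
    r ^ pwbMean y ≤ ∑' k : ℕ, pwbLaw y k * r ^ k := by
  have hμ := hexConnectiveConstant_pos
  have hy0 : 0 < y := lt_of_le_of_lt (by positivity) hy
  have hf1 := hasSum_pwbLaw_of_cube_lt hy
  have hfm : HasSum (fun k : ℕ => (k : ℝ) * pwbLaw y k) (pwbMean y) := (summable_mul_pwbLaw_of_cube_lt hy).hasSum
  set L := Real.log r with hL
  set m := pwbMean y with hm
  -- the comparison sequence `g_k = r^m (f_k + L (k f_k − m f_k))`, with sum `r^m (1 + L (m − m)) = r^m`
  have hg : HasSum (fun k : ℕ => r ^ m * (pwbLaw y k + L * ((k : ℝ) * pwbLaw y k - m * pwbLaw y k))) (r ^ m) := by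
    have h := ((hf1.add ((hfm.sub (hf1.mul_left m)).mul_left L)).mul_left (r ^ m))
    simp only [mul_one, sub_self, mul_zero, add_zero] at h
    exact h
  -- summability of `f_k r^k ≤ f_k`
  have hS : Summable fun k : ℕ => pwbLaw y k * r ^ k :=
    Summable.of_nonneg_of_le (fun k => mul_nonneg (pwbLaw_nonneg hy0.le k) (pow_nonneg hr.le k))
      (fun k => mul_le_of_le_one_right (pwbLaw_nonneg hy0.le k) (pow_le_one₀ hr.le hr1)) hf1.summable
  refine hasSum_le (fun k => ?_) hg hS.hasSum
  -- pointwise: `r^m (f + L (k f − m f)) = f · (r^m (1 + (kL − mL))) ≤ f · r^k`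
  have hrk : (r : ℝ) ^ k = Real.exp ((k : ℝ) * L) := by
    rw [← Real.rpow_natCast, Real.rpow_def_of_pos hr, mul_comm]
  have hrm : r ^ m = Real.exp (m * L) := by rw [Real.rpow_def_of_pos hr, mul_comm]
  have htan := exp_mul_one_add_sub_le_exp_src ((k : ℝ) * L) (m * L)
  have hf0 := pwbLaw_nonneg hy0.le k
  calc r ^ m * (pwbLaw y k + L * ((k : ℝ) * pwbLaw y k - m * pwbLaw y k))
      = pwbLaw y k * (Real.exp (m * L) * (1 + ((k : ℝ) * L - m * L))) := by rw [hrm]; ring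
    _ ≤ pwbLaw y k * Real.exp ((k : ℝ) * L) := mul_le_mul_of_nonneg_left htan hf0
    _ = pwbLaw y k * r ^ k := by rw [hrk]

/-! ## 3. Kesten's relation at two fugacities: `(β(y)²/β(y')²)^{m(y)} ≤ y/y'` -/

/-- `Σ_k f_k(y)·(β(y)²/β(y')²)^k = Σ_k Λ_{2k}(y) β(y')^{-2k} ≤ (y/y')·Σ_k f_k(y') = y/y'` for `μ³ < y ≤ y'` (Kesten's relation at `y'`).
[cite: MadrasSlade1993, §4.2, (4.2.4) (p. 91: Σ λ_k μ^{-k} = 1)] [cite: Kesten1963SAW, §4] -/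
theorem tsum_pwbLaw_mul_pow_le_div_of_cube_lt (hy : hexConnectiveConstant ^ 3 < y) (h : y ≤ y') :
    ∑' k : ℕ, pwbLaw y k * (wallRate y ^ 2 / wallRate y' ^ 2) ^ k ≤ y / y' := by
  have hμ := hexConnectiveConstant_pos
  have hy0 : 0 < y := lt_of_le_of_lt (by positivity) hy
  have hy'μ : hexConnectiveConstant ^ 3 < y' := lt_of_lt_of_le hy h
  have hy'0 : 0 < y' := hy0.trans_le h
  have hβ := wallRate_pos y
  have hβ' := wallRate_pos y'
  set r := wallRate y ^ 2 / wallRate y' ^ 2 with hr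
  have hr0 : 0 < r := by positivity
  have hr1 : r ≤ 1 := by
    rw [hr, div_le_one (by positivity)]
    exact pow_le_pow_left₀ hβ.le (wallRate_mono hy0 h) 2
  -- pointwise identity and bound
  have hpt : ∀ k : ℕ, pwbLaw y k * r ^ k ≤ y / y' * pwbLaw y' k := fun k => by
    have hk : pwbLaw y k * r ^ k = IPWB (2 * k) y / wallRate y' ^ (2 * k) := by
      rw [hr, div_pow, ← pow_mul, ← pow_mul, pwbLaw]
      field_simp
    rw [hk, pwbLaw, ← mul_div_assoc]
    exact div_le_div_of_nonneg_right (IPWB_le_div_mul_IPWB hy0 h (2 * k)) (pow_pos hβ' _).le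
  have hS : Summable fun k : ℕ => pwbLaw y k * r ^ k :=
    Summable.of_nonneg_of_le (fun k => mul_nonneg (pwbLaw_nonneg hy0.le k) (pow_nonneg hr0.le k))
      (fun k => mul_le_of_le_one_right (pwbLaw_nonneg hy0.le k) (pow_le_one₀ hr0.le hr1)) (hasSum_pwbLaw_of_cube_lt hy).summable
  have hS' := (hasSum_pwbLaw_of_cube_lt hy'μ).mul_left (y / y')
  rw [mul_one] at hS'
  exact hasSum_le hpt hS.hasSum hS'

/-- ★ **`(β(y)²/β(y')²)^{m(y)} ≤ y/y'`** for `μ³ < y ≤ y'` (real power; `m(y) = pwbMean y ≥ 1`).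
[cite: MadrasSlade1993, §4.2, (4.2.4) (p. 91)] [cite: Hollander2009, §7.1, Theorem 7.3(a) and (7.26) (free-energy derivative = density of pinned monomers)] -/
theorem rpow_pwbMean_sq_wallRate_div_le_of_cube_lt (hy : hexConnectiveConstant ^ 3 < y) (h : y ≤ y') :
    (wallRate y ^ 2 / wallRate y' ^ 2) ^ pwbMean y ≤ y / y' := by
  have hμ := hexConnectiveConstant_pos
  have hy0 : 0 < y := lt_of_le_of_lt (by positivity) hy
  have hβ := wallRate_pos y
  have hβ' := wallRate_pos y'
  have hr0 : 0 < wallRate y ^ 2 / wallRate y' ^ 2 := by positivity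
  have hr1 : wallRate y ^ 2 / wallRate y' ^ 2 ≤ 1 := by
    rw [div_le_one (by positivity)]
    exact pow_le_pow_left₀ hβ.le (wallRate_mono hy0 h) 2
  exact (rpow_pwbMean_le_tsum_mul_pow_of_cube_lt hy hr0 hr1).trans (tsum_pwbLaw_mul_pow_le_div_of_cube_lt hy h)

/-! ## 4. The local exponent is at least `1/m(y)`: logarithmic and power forms, strict monotonicity -/

/-- ★★ **`log (y'/y) ≤ m(y) · log (β(y')²/β(y)²)`** for `μ³ < y ≤ y'`: the growth rate increases at least like `y^{1/m(y)}` locally.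
[cite: HammersleyTorrieWhittington1982, §2] [cite: JansevanRensburg2000, §3.3, (3.17) (the log-derivative of the free energy is the energy density)]
[cite: MadrasSlade1993, §4.2, (4.2.4) (p. 91)] -/
theorem log_div_le_pwbMean_mul_log_of_cube_lt (hy : hexConnectiveConstant ^ 3 < y) (h : y ≤ y') :
    Real.log (y' / y) ≤ pwbMean y * Real.log (wallRate y' ^ 2 / wallRate y ^ 2) := by
  have hμ := hexConnectiveConstant_pos
  have hy0 : 0 < y := lt_of_le_of_lt (by positivity) hy
  have hy'0 : 0 < y' := hy0.trans_le h
  have hβ := wallRate_pos y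
  have hβ' := wallRate_pos y'
  have hm := pwbMean_pos_of_cube_lt hy
  have hr0 : 0 < wallRate y ^ 2 / wallRate y' ^ 2 := by positivity
  have h1 := rpow_pwbMean_sq_wallRate_div_le_of_cube_lt hy h
  have h2 := Real.log_le_log (Real.rpow_pos_of_pos hr0 _) h1
  rw [Real.log_rpow hr0] at h2
  have h3 : Real.log (wallRate y' ^ 2 / wallRate y ^ 2) = -Real.log (wallRate y ^ 2 / wallRate y' ^ 2) := by
    rw [← Real.log_inv, inv_div]
  have h4 : Real.log (y' / y) = -Real.log (y / y') := by rw [← Real.log_inv, inv_div]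
  rw [h3, h4]
  nlinarith

/-- `(y'/y)^{1/m(y)} ≤ β(y')²/β(y)²` for `μ³ < y ≤ y'` (power form of `log_div_le_pwbMean_mul_log_of_cube_lt`).
[cite: HammersleyTorrieWhittington1982, §2] [cite: MadrasSlade1993, §4.2, (4.2.4) (p. 91)] -/
theorem div_rpow_inv_pwbMean_le_of_cube_lt (hy : hexConnectiveConstant ^ 3 < y) (h : y ≤ y') :
    (y' / y) ^ (pwbMean y)⁻¹ ≤ wallRate y' ^ 2 / wallRate y ^ 2 := by
  have hμ := hexConnectiveConstant_pos
  have hy0 : 0 < y := lt_of_le_of_lt (by positivity) hy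
  have hy'0 : 0 < y' := hy0.trans_le h
  have hβ := wallRate_pos y
  have hβ' := wallRate_pos y'
  have hm := pwbMean_pos_of_cube_lt hy
  have hq : 0 < y' / y := by positivity
  have hR : 0 < wallRate y' ^ 2 / wallRate y ^ 2 := by positivity
  have h1 := log_div_le_pwbMean_mul_log_of_cube_lt hy h
  have h2 : (pwbMean y)⁻¹ * Real.log (y' / y) ≤ Real.log (wallRate y' ^ 2 / wallRate y ^ 2) := by
    rw [inv_mul_le_iff₀ hm]
    exact h1
  calc (y' / y) ^ (pwbMean y)⁻¹ = Real.exp ((pwbMean y)⁻¹ * Real.log (y' / y)) := by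
        rw [Real.rpow_def_of_pos hq, mul_comm]
    _ ≤ Real.exp (Real.log (wallRate y' ^ 2 / wallRate y ^ 2)) := Real.exp_le_exp.2 h2
    _ = wallRate y' ^ 2 / wallRate y ^ 2 := Real.exp_log hR

/-- ★★ **Two-sided local exponent**: `log(y'/y)/m(y) ≤ log(β(y')²/β(y)²) ≤ log(y'/y)` for `μ³ < y ≤ y'` (upper: tree `wallRate_le_sqrt_mul`).
[cite: BeatonBousquetMelouDeGierDuminilCopinGuttmann2014, §3.1, Proposition 5 (arXiv v5 p. 9: non-decreasing, log-convex; p. 10: μ(y) ∼ √y)]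
[cite: HammersleyTorrieWhittington1982, §2] [cite: MadrasSlade1993, §4.2, (4.2.4) (p. 91)] -/
theorem log_sq_wallRate_div_two_sided_of_cube_lt (hy : hexConnectiveConstant ^ 3 < y) (h : y ≤ y') :
    Real.log (y' / y) / pwbMean y ≤ Real.log (wallRate y' ^ 2 / wallRate y ^ 2) ∧
      Real.log (wallRate y' ^ 2 / wallRate y ^ 2) ≤ Real.log (y' / y) := by
  have hμ := hexConnectiveConstant_pos
  have hy0 : 0 < y := lt_of_le_of_lt (by positivity) hy
  have hy'0 : 0 < y' := hy0.trans_le h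
  have hβ := wallRate_pos y
  have hβ' := wallRate_pos y'
  have hm := pwbMean_pos_of_cube_lt hy
  refine ⟨?_, ?_⟩
  · rw [div_le_iff₀ hm, mul_comm]
    exact log_div_le_pwbMean_mul_log_of_cube_lt hy h
  · have hu := wallRate_le_sqrt_mul hy0 h
    have hq : 0 ≤ y' / y := by positivity
    have hsq : wallRate y' ^ 2 ≤ y' / y * wallRate y ^ 2 := by
      calc wallRate y' ^ 2 ≤ (Real.sqrt (y' / y) * wallRate y) ^ 2 :=
            pow_le_pow_left₀ hβ'.le hu 2
        _ = y' / y * wallRate y ^ 2 := by rw [mul_pow, Real.sq_sqrt hq]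
    have hR : wallRate y' ^ 2 / wallRate y ^ 2 ≤ y' / y := by
      rw [div_le_iff₀ (by positivity)]
      exact hsq
    exact Real.log_le_log (by positivity) hR

/-- ★ **Strict monotonicity**: `μ³ < y < y' → β(y) < β(y')`.
[cite: HammersleyTorrieWhittington1982, §2] [cite: JansevanRensburg2000, §5.4, Theorem 5.55 and the preceding paragraph (desorbed: zero density of visits; adsorbed: positive density)]
[cite: Madras2017, §1 (desorbed regime `F(β) = F(0)`, adsorbed regime `F(β) > F(0)`)] -/
theorem wallRate_lt_wallRate_of_cube_lt (hy : hexConnectiveConstant ^ 3 < y) (h : y < y') : wallRate y < wallRate y' := by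
  have hμ := hexConnectiveConstant_pos
  have hy0 : 0 < y := lt_of_le_of_lt (by positivity) hy
  have hy'0 : 0 < y' := hy0.trans h
  have hβ := wallRate_pos y
  have hβ' := wallRate_pos y'
  have hm := pwbMean_pos_of_cube_lt hy
  have h1 := log_div_le_pwbMean_mul_log_of_cube_lt hy h.le
  have hpos : 0 < Real.log (y' / y) := Real.log_pos (by rw [lt_div_iff₀ hy0, one_mul]; exact h)
  by_contra hle
  have hle' : wallRate y' ≤ wallRate y := le_of_not_gt hle
  have hR1 : wallRate y' ^ 2 / wallRate y ^ 2 ≤ 1 := by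
    rw [div_le_one (by positivity)]
    exact pow_le_pow_left₀ hβ'.le hle' 2
  have hlog : Real.log (wallRate y' ^ 2 / wallRate y ^ 2) ≤ 0 := Real.log_nonpos (by positivity) hR1
  nlinarith

/-- ★ `β = wallRate` is strictly increasing on `(μ³, ∞)`.
[cite: HammersleyTorrieWhittington1982, §2] [cite: JansevanRensburg2000, §5.4, Theorem 5.55 and the preceding paragraph] -/
theorem strictMonoOn_wallRate_of_cube_lt : StrictMonoOn wallRate (Set.Ioi (hexConnectiveConstant ^ 3)) :=
  fun _ hy _ _ h => wallRate_lt_wallRate_of_cube_lt hy h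

/-! ## 5. Explicit exponents: `1/M(y)` pointwise, and `1/M₀` uniformly on `[y₀, ∞)` given a mean certificate -/

/-- The explicit exponent: `log(y'/y) ≤ M₃(y)·log(β(y')²/β(y)²)`, `M₃(y) = 1 + (μ² + y^{2/3}/μ²) θ₃²/(1−θ₃)²`, `θ₃ = μ²/y^{2/3}`
(`pwbMean_le_of_cube_lt` of `HexSAWSurfaceWallRenewalCubeRange`), for `μ³ < y ≤ y'`.
[cite: MadrasSlade1993, §4.2, Theorem 4.2.2 (pp. 91–92)] [cite: Feller1968, XIII.10, Theorem 1 (renewal theorem with finite mean)] -/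
theorem log_div_le_explicit_mul_log_of_cube_lt (hy : hexConnectiveConstant ^ 3 < y) (h : y ≤ y') :
    Real.log (y' / y) ≤ (1 + (hexConnectiveConstant ^ 2 + y ^ ((2 : ℝ) / 3) / hexConnectiveConstant ^ 2) *
      (hexConnectiveConstant ^ 2 / y ^ ((2 : ℝ) / 3) *
        (hexConnectiveConstant ^ 2 / y ^ ((2 : ℝ) / 3) / (1 - hexConnectiveConstant ^ 2 / y ^ ((2 : ℝ) / 3)) ^ 2))) *
        Real.log (wallRate y' ^ 2 / wallRate y ^ 2) := by
  have hμ := hexConnectiveConstant_pos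
  have hy0 : 0 < y := lt_of_le_of_lt (by positivity) hy
  have hβ := wallRate_pos y
  have hβ' := wallRate_pos y'
  have h1 := log_div_le_pwbMean_mul_log_of_cube_lt hy h
  have hR : 1 ≤ wallRate y' ^ 2 / wallRate y ^ 2 := by
    rw [le_div_iff₀ (by positivity), one_mul]
    exact pow_le_pow_left₀ hβ.le (wallRate_mono hy0 h) 2
  have hlog : 0 ≤ Real.log (wallRate y' ^ 2 / wallRate y ^ 2) := Real.log_nonneg hR
  exact h1.trans (mul_le_mul_of_nonneg_right (pwbMean_le_of_cube_lt hy) hlog)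

/-- **Uniform exponent from a mean certificate.**  If `m(y) ≤ M₀` for all `y ≥ y₀` (`y₀ > μ³`, `M₀ > 0`), then for `y₀ ≤ y ≤ y'`:
`log(y'/y) ≤ M₀ · log(β(y')²/β(y)²)`.
[cite: HammersleyTorrieWhittington1982, §2] [cite: MadrasSlade1993, §4.2, (4.2.4) and Theorem 4.2.2 (pp. 91–92)] -/
theorem log_div_le_mul_log_of_pwbMean_le_of_cube_lt {y₀ M₀ : ℝ} (hy₀ : hexConnectiveConstant ^ 3 < y₀)
    (hM : ∀ y, y₀ ≤ y → pwbMean y ≤ M₀) (hy : y₀ ≤ y) (h : y ≤ y') :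
    Real.log (y' / y) ≤ M₀ * Real.log (wallRate y' ^ 2 / wallRate y ^ 2) := by
  have hμ := hexConnectiveConstant_pos
  have hyμ : hexConnectiveConstant ^ 3 < y := lt_of_lt_of_le hy₀ hy
  have hy0 : 0 < y := lt_of_le_of_lt (by positivity) hyμ
  have hβ := wallRate_pos y
  have hβ' := wallRate_pos y'
  have h1 := log_div_le_pwbMean_mul_log_of_cube_lt hyμ h
  have hR : 1 ≤ wallRate y' ^ 2 / wallRate y ^ 2 := by
    rw [le_div_iff₀ (by positivity), one_mul]
    exact pow_le_pow_left₀ hβ.le (wallRate_mono hy0 h) 2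
  have hlog : 0 ≤ Real.log (wallRate y' ^ 2 / wallRate y ^ 2) := Real.log_nonneg hR
  exact h1.trans (mul_le_mul_of_nonneg_right (hM y hy) hlog)

/-- ★ **`log β(y)² − (log y)/M₀` is non-decreasing on `[y₀, ∞)`** whenever `m ≤ M₀` on `[y₀, ∞)` (`y₀ > μ³`, `M₀ > 0`) — the counterpart of
the tree's non-increasing `β(y)²/y`; as `y₀ → ∞` one may take `M₀ → 1`.
[cite: BeatonBousquetMelouDeGierDuminilCopinGuttmann2014, §3.1, Proposition 5 (arXiv v5 p. 9)] [cite: HammersleyTorrieWhittington1982, §2]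
[cite: MadrasSlade1993, §4.2, (4.2.4) (p. 91)] -/
theorem monotoneOn_log_sq_wallRate_sub_of_cube_lt {y₀ M₀ : ℝ} (hy₀ : hexConnectiveConstant ^ 3 < y₀) (hM0 : 0 < M₀)
    (hM : ∀ y, y₀ ≤ y → pwbMean y ≤ M₀) :
    MonotoneOn (fun y => Real.log (wallRate y ^ 2) - Real.log y / M₀) (Set.Ici y₀) := by
  intro y hy y' _ h
  have hμ := hexConnectiveConstant_pos
  have hyμ : hexConnectiveConstant ^ 3 < y := lt_of_lt_of_le hy₀ hy
  have hy0 : 0 < y := lt_of_le_of_lt (by positivity) hyμ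
  have hy'0 : 0 < y' := hy0.trans_le h
  have hβ := wallRate_pos y
  have hβ' := wallRate_pos y'
  have h1 := log_div_le_mul_log_of_pwbMean_le_of_cube_lt hy₀ hM hy h
  rw [Real.log_div hy'0.ne' hy0.ne', Real.log_div (by positivity) (by positivity)] at h1
  have h2 : (Real.log y' - Real.log y) / M₀ ≤ Real.log (wallRate y' ^ 2) - Real.log (wallRate y ^ 2) := by
    rw [div_le_iff₀ hM0, mul_comm]
    exact h1
  show Real.log (wallRate y ^ 2) - Real.log y / M₀ ≤ Real.log (wallRate y' ^ 2) - Real.log y' / M₀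
  rw [sub_div] at h2
  linarith

end Literature.Probability.RandomPlanarGeometry.SAW.HexBW.Wall

end
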